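import Summits.AtomisticToContinuum.HydrodynamicLimit.Theorems.RelayRaceLocalityNearConstantShortTimeHLMeansPinDefs
import Summits.AtomisticToContinuum.HydrodynamicLimit.Theorems.RelayRaceLocalityNearConstantShortTimeHLMeansNecessaryStatic
import Summits.AtomisticToContinuum.HydrodynamicLimit.Theorems.RelayRaceLocalityNearConstantShortTimeHLMeansNecessaryTools
import Summits.AtomisticToContinuum.HydrodynamicLimit.Theorems.RelayRaceLocalityNearConstantShortTimeHLMeansNecessaryFields
import Summits.AtomisticToContinuum.HydrodynamicLimit.Theorems.RelayRaceLocalityNearConstantShortTimeHLMeansNecessaryKinetic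
import Summits.AtomisticToContinuum.HydrodynamicLimit.Theorems.ImplosionDichotomyHsEosLowDensity
import Summits.AtomisticToContinuum.HydrodynamicLimit.Theorems.VitaliAmplitudeTransferAmplitudeTransferIdentification
import HarnessLib

/-!
# Crux `NearConstantShortTimeHL` (stmt-AtomisticToContinuum-12502), line `means-pin-entropy` — the crux implies convergence of the means

Support file for the crux `…Theses.RelayRaceLocality.NearConstantShortTimeHL`, line `means-pin-entropy` (lead
prover-line-stmt-AtomisticToContinuum-12502-a1-0): the registered sub-goal
`meansConverge_of_nearConstantShortTimeHL : NearConstantShortTimeHL → MeansConverge`, the CONVERSE of the engine target.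
Together with the landed engine bridge `oneMeanLowerBound_of_meansConverge : MeansConverge → OneMeanLowerBound`
(`…MeansPinDefs.lean`) and the pin `stub_meansPin` (statics), it certifies that the engine slot of the line
(`OneMeanLowerBound`) and the dock currency of both engine lines (`MeansConverge`) are EXACTLY crux-strength: the
near-constant short-time hydrodynamic limit in its leanest currency.

PROOF (no fourth moments, no identification of the Euler data). Fix the crux's witnesses and shrink `η₀` to
`min η₀ η_E`, `η_E` the analytic band of the equation of state (so that classical solutions conserve `∫ E` on `[0, t]`,
`integral_totalEnergyDensity_eq`). Inside the frame, for a continuous `χ` with `|χ| ≤ C`: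
* DENSITY: `|ρ_N[χ]| ≤ C`, so the law of large numbers at `t` (the crux) upgrades to convergence of expectations by
  bounded convergence (`HardSphereLDA.tendsto_integral_of_tendsto_measure`).
* MOMENTUM: coordinatewise, `(m_N[χ]ₗ)² ≤ C² · n⁻¹∑‖vᵢ(t)‖²`, whose expectation is CONSERVED along the flow
  (`sum_norm_sq_vel_flow_ae`) and equals its static value `≤ 3 sup θ₀ + sup ‖u₀‖²` at `t = 0` (Gaussian velocities given
  the positions, `lintegral_avg_norm_sq_vel_le`): a uniform second-moment bound, so convergence in probability upgrades
  (`tendsto_integral_of_tendsto_measure_of_sq_le`); then recombine the coordinates.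
* ENERGY: for `ψ ≥ 0` the expectation is asymptotically `≥ ∫ψE_t` by Markov from below
  (`le_integral_of_tendsto_measure_of_nonneg`), and `≤` by the same bound for `W − ψ` once the TOTAL kinetic energy is
  known to converge in mean: `E[K_N(t)] = E[K_N(0)]` (conservation) `= E[n⁻¹∑(‖u₀(xᵢ)‖²/2 + 3θ₀(xᵢ)/2)]` (Gaussian
  conditional mean, `lintegral_kinetic_eq_lintegral_condMean`) `→ ∫ E₀` (a BOUNDED position observable converging in
  probability to `∫E₀` because `K_N(0)` does — the tie — and `K_N(0)` is Chebyshev-close to it,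
  `particleLaw_energyFluct_le`) `= ∫ E_t` (Euler energy conservation in the band). Signed `χ = χ⁺ − χ⁻` by linearity.
References: H.-T. Yau, Lett. Math. Phys. 22 (1991) §2; C. Kipnis – C. Landim (1999), App. 1; H. Spohn (1991), Part I §2.3, Ch. 3.
-/

noncomputable section

namespace Summit.AtomisticToContinuum.HydrodynamicLimit.Theorems.NearConstantShortTimeHL

open scoped BigOperators ENNReal Topology
open MeasureTheory Set Filter
open Literature.MathematicalPhysics.KineticTheory Literature.Analysis.FluidPDE Literature.Analysis.FunctionSpaces
open Summit.AtomisticToContinuum.HydrodynamicLimit.Theses.RelayRaceLocality (NearConstantShortTimeHL)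
open Summit.AtomisticToContinuum.HydrodynamicLimit.Theorems.AmplitudeTransfer (integral_apply_V3)

/-- **THE CRUX IMPLIES CONVERGENCE OF THE MEANS** (registered sub-goal `meansConverge_of_nearConstantShortTimeHL` of
crux stmt-AtomisticToContinuum-12502, line `means-pin-entropy`): `NearConstantShortTimeHL → MeansConverge`, with
witnesses `η₀ := min η₀ η_E` (`η_E` the analytic band of the hard-sphere equation of state, `hsEosLowDensity_proof`)
and the crux's `δ₀, τ₀, σ₀`. See the module docstring for the proof. [cite: Yau1991, §2] -/
theorem meansConverge_of_nearConstantShortTimeHL : NearConstantShortTimeHL → MeansConverge := by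
  rintro ⟨η₁, hη₁, H⟩
  obtain ⟨ηE, hηE, F, hFa, hEq, -⟩ := hsEosLowDensity_proof
  refine ⟨min η₁ ηE, lt_min hη₁ hηE, fun M hM => ?_⟩
  obtain ⟨δ₀, hδ₀, τ₀, hτ₀, H1⟩ := H M hM
  refine ⟨δ₀, hδ₀, τ₀, hτ₀, fun a₀ θ₀ u₀ ha hθ hu ha0 hθ0 => ?_⟩
  obtain ⟨σ₀, hσ₀, H2⟩ := H1 a₀ θ₀ u₀ ha hθ hu ha0 hθ0
  refine ⟨σ₀, hσ₀, ?_⟩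
  intro σ hσ hσ' ε n hε hε0 hn T ρ θ u hE hnc Φ P hP h0 t ht hg χ hχ
  -- the law, written out, and its basic properties
  haveI hPI : ∀ N, IsProbabilityMeasure (P N) := hP
  haveI hPI' : ∀ N, IsProbabilityMeasure (particleLaw (Φ N)
      (canonicalDensity (Torus.geometry (Fin 3)) (ε N) (n N) (localGibbsProfile a₀ u₀ θ₀))) := hP
  have hPac : ∀ N, P N ≪ liouville (Torus.geometry (Fin 3)) (n N) (ε N) := fun N =>
    particleLaw_absolutelyContinuous (Φ N) _
  have ha0' : ∀ x, 0 ≤ a₀ x := fun x => (ha0 x).le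
  -- the law of large numbers at `t` (the crux) for the `η₁`-guards
  have hg' : ∀ s ∈ Icc 0 t, ∀ x, ρ s x * σ ^ 3 < η₁ ∧ θ s x ≤ M ∧ M⁻¹ ≤ θ s x ∧ ‖u s x‖ ≤ M ∧
      ∀ i : Fin 3, |Torus.partialDeriv i (ρ s) x| ≤ M ∧ ‖Torus.partialDeriv i (u s) x‖ ≤ M ∧
        |Torus.partialDeriv i (θ s) x| ≤ M :=
    fun s hs x => ⟨(hg s hs x).1.trans_le (min_le_left _ _), (hg s hs x).2⟩
  have HL := H2 σ hσ hσ' ε n hε hε0 hn T ρ θ u hE hnc Φ hP h0 t ht hg'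
  have hband : ∀ s ∈ Icc 0 t, ∀ x, ρ s x * σ ^ 3 < ηE := fun s hs x =>
    (hg s hs x).1.trans_le (min_le_right _ _)
  have hn_top : Tendsto n atTop atTop := tendsto_atTop_of_tendsto_mul_pow_three hσ hε hε0 hn
  -- the time-`t` and time-`0` slices
  have htT : t ∈ Ico 0 T := ⟨ht.1, ht.2.trans_le (min_le_left _ _)⟩
  have hρc : Continuous (ρ t) := (hE.smooth_density.isSmooth_slice htT).continuous
  have huc : Continuous (u t) := (hE.smooth_velocity.isSmooth_slice htT).continuous
  have hθc : Continuous (θ t) := (hE.smooth_temperature.isSmooth_slice htT).continuous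
  have hEtc : Continuous fun x => totalEnergyDensity (ρ t x) (u t x) (θ t x) := by
    unfold totalEnergyDensity
    exact hρc.mul (((huc.norm.pow 2).div_const 2).add (continuous_const.mul hθc))
  -- bounds on the profiles and on the test function
  obtain ⟨Θ, hΘ0, hΘ⟩ := exists_forall_abs_le_of_continuous hθ
  obtain ⟨U, hU0, hU⟩ := exists_forall_abs_le_of_continuous (continuous_norm.comp hu)
  have hU' : ∀ x, ‖u₀ x‖ ≤ U := fun x => (le_abs_self _).trans (hU x)
  obtain ⟨Cχ, hCχ0, hCχ⟩ := exists_forall_abs_le_of_continuous hχ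
  set B₁ : ℝ := 3 * Θ + U ^ 2 with hB₁def
  have hB₁ : ∀ x, 3 * θ₀ x + ‖u₀ x‖ ^ 2 ≤ B₁ := fun x => by
    have h1 : θ₀ x ≤ Θ := (le_abs_self _).trans (hΘ x)
    have h2 : ‖u₀ x‖ ^ 2 ≤ U ^ 2 := pow_le_pow_left₀ (norm_nonneg _) (hU' x) 2
    rw [hB₁def]
    linarith
  /- ### Uniform second velocity moment, at every time (conservation + statics at `t = 0`) -/
  have hV0 : ∀ N, ∫⁻ z, ENNReal.ofReal (((n N : ℕ) : ℝ)⁻¹ * ∑ i, ‖(z i).2‖ ^ 2) ∂P N ≤ ENNReal.ofReal B₁ :=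
    fun N => lintegral_avg_norm_sq_vel_le (Φ N) ha hθ hu ha0' hθ0 hB₁
  have hVs : ∀ (N : ℕ) (s : ℝ),
      ∫⁻ z, ENNReal.ofReal (((n N : ℕ) : ℝ)⁻¹ * ∑ i, ‖((Φ N).flow s z i).2‖ ^ 2) ∂P N ≤ ENNReal.ofReal B₁ := by
    intro N s
    have hae := sum_norm_sq_vel_flow_ae (Φ N) (hPac N) s
    calc ∫⁻ z, ENNReal.ofReal (((n N : ℕ) : ℝ)⁻¹ * ∑ i, ‖((Φ N).flow s z i).2‖ ^ 2) ∂P N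
        = ∫⁻ z, ENNReal.ofReal (((n N : ℕ) : ℝ)⁻¹ * ∑ i, ‖(z i).2‖ ^ 2) ∂P N := by
          refine lintegral_congr_ae (hae.mono fun z hz => ?_)
          show ENNReal.ofReal (((n N : ℕ) : ℝ)⁻¹ * ∑ i, ‖((Φ N).flow s z i).2‖ ^ 2) =
            ENNReal.ofReal (((n N : ℕ) : ℝ)⁻¹ * ∑ i, ‖(z i).2‖ ^ 2)
          rw [show (∑ i, ‖((Φ N).flow s z i).2‖ ^ 2) = ∑ i, ‖(z i).2‖ ^ 2 from hz]
      _ ≤ ENNReal.ofReal B₁ := hV0 N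
  have hKm : ∀ (N : ℕ) (s : ℝ) (c : ℝ),
      Measurable fun z : Config (n N) (Fin 3) T3 => c * ∑ i, ‖((Φ N).flow s z i).2‖ ^ 2 := by
    intro N s c
    have h : Measurable fun w : Config (n N) (Fin 3) T3 => c * ∑ i, ‖(w i).2‖ ^ 2 :=
      measurable_const.mul (Finset.measurable_sum _ fun i _ => ((measurable_pi_apply i).snd).norm.pow_const 2)
    exact h.comp ((Φ N).measurable_flow s)
  have hKi : ∀ (N : ℕ) (s : ℝ),
      Integrable (fun z => ((n N : ℕ) : ℝ)⁻¹ * ∑ i, ‖((Φ N).flow s z i).2‖ ^ 2) (P N) := by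
    intro N s
    refine ⟨(hKm N s _).aestronglyMeasurable, ?_⟩
    rw [hasFiniteIntegral_iff_ofReal (Eventually.of_forall fun z =>
      mul_nonneg (inv_nonneg.2 (Nat.cast_nonneg _)) (Finset.sum_nonneg fun i _ => sq_nonneg _))]
    exact (hVs N s).trans_lt ENNReal.ofReal_lt_top
  /- ### DENSITY -/
  have hDm : ∀ N, Measurable fun z => empiricalDensityField ((Φ N).flow t z) χ := fun N =>
    (continuous_empiricalDensityField hχ).measurable.comp ((Φ N).measurable_flow t)
  have hDb : ∀ N z, |empiricalDensityField ((Φ N).flow t z) χ| ≤ Cχ := fun N z =>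
    abs_empiricalDensityField_le hCχ hCχ0 _
  have hDi : ∀ N, Integrable (fun z => empiricalDensityField ((Φ N).flow t z) χ) (P N) := fun N =>
    Integrable.of_bound (hDm N).aestronglyMeasurable Cχ
      (Eventually.of_forall fun z => (Real.norm_eq_abs _).trans_le (hDb N z))
  have hDT : Tendsto (fun N => ∫ z, empiricalDensityField ((Φ N).flow t z) χ ∂P N) atTop
      (𝓝 (∫ x, χ x * ρ t x)) :=
    HardSphereLDA.tendsto_integral_of_tendsto_measure P hDm hDb fun δ hδ => (HL χ hχ δ hδ).1
  /- ### MOMENTUM -/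
  have hMm : ∀ N, Measurable fun z => empiricalMomentumField ((Φ N).flow t z) χ := fun N =>
    (continuous_empiricalMomentumField hχ).measurable.comp ((Φ N).measurable_flow t)
  have hMlm : ∀ (N : ℕ) (l : Fin 3), Measurable fun z => empiricalMomentumField ((Φ N).flow t z) χ l :=
    fun N l => (EuclideanSpace.proj (𝕜 := ℝ) l).measurable.comp (hMm N)
  have hMl2 : ∀ (N : ℕ) (l : Fin 3),
      ∫⁻ z, ENNReal.ofReal ((empiricalMomentumField ((Φ N).flow t z) χ l) ^ 2) ∂P N ≤
        ENNReal.ofReal (Cχ ^ 2 * B₁) := by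
    intro N l
    have hpt : ∀ z, ENNReal.ofReal ((empiricalMomentumField ((Φ N).flow t z) χ l) ^ 2) ≤
        ENNReal.ofReal (Cχ ^ 2) * ENNReal.ofReal (((n N : ℕ) : ℝ)⁻¹ * ∑ i, ‖((Φ N).flow t z i).2‖ ^ 2) := by
      intro z
      rw [← ENNReal.ofReal_mul (sq_nonneg _)]
      refine ENNReal.ofReal_le_ofReal ?_
      have h1 : |empiricalMomentumField ((Φ N).flow t z) χ l| ≤ ‖empiricalMomentumField ((Φ N).flow t z) χ‖ := by
        simpa using abs_apply_sub_le_norm (empiricalMomentumField ((Φ N).flow t z) χ) 0 l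
      calc (empiricalMomentumField ((Φ N).flow t z) χ l) ^ 2
          = |empiricalMomentumField ((Φ N).flow t z) χ l| ^ 2 := (sq_abs _).symm
        _ ≤ ‖empiricalMomentumField ((Φ N).flow t z) χ‖ ^ 2 := pow_le_pow_left₀ (abs_nonneg _) h1 2
        _ ≤ Cχ ^ 2 * (((n N : ℕ) : ℝ)⁻¹ * ∑ i, ‖((Φ N).flow t z i).2‖ ^ 2) :=
            norm_empiricalMomentumField_sq_le hCχ hCχ0 _
    calc ∫⁻ z, ENNReal.ofReal ((empiricalMomentumField ((Φ N).flow t z) χ l) ^ 2) ∂P N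
        ≤ ∫⁻ z, ENNReal.ofReal (Cχ ^ 2) *
            ENNReal.ofReal (((n N : ℕ) : ℝ)⁻¹ * ∑ i, ‖((Φ N).flow t z i).2‖ ^ 2) ∂P N := lintegral_mono hpt
      _ = ENNReal.ofReal (Cχ ^ 2) *
            ∫⁻ z, ENNReal.ofReal (((n N : ℕ) : ℝ)⁻¹ * ∑ i, ‖((Φ N).flow t z i).2‖ ^ 2) ∂P N :=
          lintegral_const_mul' _ _ ENNReal.ofReal_ne_top
      _ ≤ ENNReal.ofReal (Cχ ^ 2) * ENNReal.ofReal B₁ := mul_le_mul_right (hVs N t) _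
      _ = ENNReal.ofReal (Cχ ^ 2 * B₁) := (ENNReal.ofReal_mul (sq_nonneg _)).symm
  have hIl : ∀ l : Fin 3, (∫ x, (χ x * ρ t x) • u t x) l = ∫ x, χ x * ρ t x * u t x l := fun l => by
    have hi : Integrable (fun x => (χ x * ρ t x) • u t x) (volume : Measure T3) :=
      integrable_of_continuous_T3 ((hχ.mul hρc).smul huc)
    rw [integral_apply_V3 hi l]
    rfl
  have hMlP : ∀ (l : Fin 3) (δ : ℝ), 0 < δ → Tendsto (fun N => P N {z | δ <
      |empiricalMomentumField ((Φ N).flow t z) χ l - ∫ x, χ x * ρ t x * u t x l|}) atTop (𝓝 0) := by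
    intro l δ hδ
    refine tendsto_of_tendsto_of_tendsto_of_le_of_le tendsto_const_nhds (HL χ hχ δ hδ).2.1
      (fun N => bot_le) fun N => ?_
    refine measure_mono fun z hz => ?_
    simp only [mem_setOf_eq] at hz ⊢
    rw [← hIl l] at hz
    exact hz.trans_le (abs_apply_sub_le_norm _ _ l)
  have hMlT : ∀ l : Fin 3, Tendsto (fun N => ∫ z, empiricalMomentumField ((Φ N).flow t z) χ l ∂P N) atTop
      (𝓝 (∫ x, χ x * ρ t x * u t x l)) := fun l =>
    tendsto_integral_of_tendsto_measure_of_sq_le P (fun N => hMlm N l) (fun N => hMl2 N l) (hMlP l)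
  have hMi : ∀ N, Integrable (fun z => empiricalMomentumField ((Φ N).flow t z) χ) (P N) := by
    intro N
    refine Integrable.mono' (((integrable_const (1 : ℝ)).add (hKi N t)).const_mul Cχ) (hMm N).aestronglyMeasurable
      (Eventually.of_forall fun z => ?_)
    set K : ℝ := ((n N : ℕ) : ℝ)⁻¹ * ∑ i, ‖((Φ N).flow t z i).2‖ ^ 2 with hK
    have hK0 : 0 ≤ K := mul_nonneg (inv_nonneg.2 (Nat.cast_nonneg _)) (Finset.sum_nonneg fun i _ => sq_nonneg _)
    have h := norm_empiricalMomentumField_sq_le hCχ hCχ0 ((Φ N).flow t z)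
    rw [← hK] at h
    show ‖empiricalMomentumField ((Φ N).flow t z) χ‖ ≤ Cχ * (1 + K)
    have h2 : ‖empiricalMomentumField ((Φ N).flow t z) χ‖ ^ 2 ≤ (Cχ * (1 + K)) ^ 2 := by
      calc ‖empiricalMomentumField ((Φ N).flow t z) χ‖ ^ 2 ≤ Cχ ^ 2 * K := h
        _ ≤ (Cχ * (1 + K)) ^ 2 := by
            rw [mul_pow]
            exact mul_le_mul_of_nonneg_left (by nlinarith) (sq_nonneg _)
    exact (pow_le_pow_iff_left₀ (norm_nonneg _) (by positivity) two_ne_zero).1 h2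
  have hMT : Tendsto (fun N => ∫ z, empiricalMomentumField ((Φ N).flow t z) χ ∂P N) atTop
      (𝓝 (∫ x, (χ x * ρ t x) • u t x)) := by
    refine tendsto_V3_of_apply fun l => ?_
    rw [hIl l]
    refine (hMlT l).congr fun N => ?_
    exact (integral_apply_V3 (hMi N) l).symm
  /- ### ENERGY, step 1: the total kinetic energy converges in mean (conservation + statics + Euler) -/
  set IE : ℝ := ∫ x, (fun _ => (1 : ℝ)) x * totalEnergyDensity (ρ 0 x) (u 0 x) (θ 0 x) with hIEdef
  have hKT0 : Tendsto (fun N => ∫ z, empiricalEnergyField ((Φ N).flow t z) (fun _ => (1 : ℝ)) ∂P N) atTop (𝓝 IE) :=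
    tendsto_integral_kineticEnergy ha hθ hu ha0 hθ0 Φ hn_top hP
      (fun δ hδ => (h0 (fun _ => (1 : ℝ)) continuous_const δ hδ).2.2) t
  have hIE : IE = ∫ x, totalEnergyDensity (ρ t x) (u t x) (θ t x) := by
    rw [hIEdef, integral_totalEnergyDensity_eq hFa hEq hσ hE htT hband]
    simp
  have hKT : Tendsto (fun N => ∫ z, empiricalEnergyField ((Φ N).flow t z) (fun _ => (1 : ℝ)) ∂P N) atTop
      (𝓝 (∫ x, totalEnergyDensity (ρ t x) (u t x) (θ t x))) := by
    rw [← hIE]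
    exact hKT0
  /- ### ENERGY, step 2: nonnegative test functions, then signed ones -/
  have hEm : ∀ (ψ : T3 → ℝ), Continuous ψ → ∀ N, Measurable fun z => empiricalEnergyField ((Φ N).flow t z) ψ :=
    fun ψ hψ N => (continuous_empiricalEnergyField hψ).measurable.comp ((Φ N).measurable_flow t)
  have hEi : ∀ (ψ : T3 → ℝ), Continuous ψ → ∀ N, Integrable (fun z => empiricalEnergyField ((Φ N).flow t z) ψ) (P N) := by
    intro ψ hψ N
    obtain ⟨W, hW0, hW⟩ := exists_forall_abs_le_of_continuous hψ
    refine Integrable.mono' ((hKi N t).const_mul (W / 2)) (hEm ψ hψ N).aestronglyMeasurable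
      (Eventually.of_forall fun z => ?_)
    rw [Real.norm_eq_abs]
    refine (abs_empiricalEnergyField_le hW _).trans (le_of_eq ?_)
    rw [Finset.mul_sum, Finset.mul_sum, Finset.mul_sum, Finset.mul_sum]
    exact Finset.sum_congr rfl fun i _ => by ring
  have key : ∀ (ψ : T3 → ℝ), Continuous ψ → (∀ x, 0 ≤ ψ x) →
      Tendsto (fun N => ∫ z, empiricalEnergyField ((Φ N).flow t z) ψ ∂P N) atTop
        (𝓝 (∫ x, ψ x * totalEnergyDensity (ρ t x) (u t x) (θ t x))) := by
    intro ψ hψ hψ0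
    obtain ⟨W, hW0, hW⟩ := exists_forall_abs_le_of_continuous hψ
    set c : ℝ := ∫ x, ψ x * totalEnergyDensity (ρ t x) (u t x) (θ t x) with hcdef
    set et : ℝ := ∫ x, totalEnergyDensity (ρ t x) (u t x) (θ t x) with hetdef
    -- the complementary test function
    set ψ' : T3 → ℝ := fun x => W - ψ x with hψ'def
    have hψ'c : Continuous ψ' := continuous_const.sub hψ
    have hψ'0 : ∀ x, 0 ≤ ψ' x := fun x => by
      have := (le_abs_self _).trans (hW x)
      rw [hψ'def]
      linarith
    have hiE : Integrable (fun x => totalEnergyDensity (ρ t x) (u t x) (θ t x)) (volume : Measure T3) :=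
      integrable_of_continuous_T3 hEtc
    have hiψE : Integrable (fun x => ψ x * totalEnergyDensity (ρ t x) (u t x) (θ t x)) (volume : Measure T3) :=
      integrable_of_continuous_T3 (hψ.mul hEtc)
    have hc' : ∫ x, ψ' x * totalEnergyDensity (ρ t x) (u t x) (θ t x) = W * et - c := by
      have e : ∀ x, ψ' x * totalEnergyDensity (ρ t x) (u t x) (θ t x) =
          W * totalEnergyDensity (ρ t x) (u t x) (θ t x) - ψ x * totalEnergyDensity (ρ t x) (u t x) (θ t x) :=
        fun x => by rw [hψ'def]; ring
      simp_rw [e]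
      have e1 : ∫ x, (W * totalEnergyDensity (ρ t x) (u t x) (θ t x) - ψ x * totalEnergyDensity (ρ t x) (u t x) (θ t x)) =
          (∫ x, W * totalEnergyDensity (ρ t x) (u t x) (θ t x)) - ∫ x, ψ x * totalEnergyDensity (ρ t x) (u t x) (θ t x) :=
        integral_sub (hiE.const_mul W) hiψE
      rw [e1, integral_const_mul]
    -- lower bounds for `ψ` and `ψ'`
    have hlow : ∀ κ : ℝ, 0 < κ → ∀ᶠ N in atTop, c - κ ≤ ∫ z, empiricalEnergyField ((Φ N).flow t z) ψ ∂P N :=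
      fun κ hκ => le_integral_of_tendsto_measure_of_nonneg P (hEm ψ hψ)
        (fun N z => empiricalEnergyField_nonneg hψ0 _) (hEi ψ hψ) (fun δ hδ => (HL ψ hψ δ hδ).2.2) hκ
    have hlow' : ∀ κ : ℝ, 0 < κ → ∀ᶠ N in atTop, (W * et - c) - κ ≤ ∫ z, empiricalEnergyField ((Φ N).flow t z) ψ' ∂P N := by
      intro κ hκ
      have h := le_integral_of_tendsto_measure_of_nonneg P (hEm ψ' hψ'c)
        (fun N z => empiricalEnergyField_nonneg hψ'0 _) (hEi ψ' hψ'c) (fun δ hδ => (HL ψ' hψ'c δ hδ).2.2) hκ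
      rwa [hc'] at h
    -- the decomposition `e[ψ] + e[ψ'] = W · K`
    have hsum : ∀ N, ∫ z, empiricalEnergyField ((Φ N).flow t z) ψ ∂P N +
        ∫ z, empiricalEnergyField ((Φ N).flow t z) ψ' ∂P N =
        W * ∫ z, empiricalEnergyField ((Φ N).flow t z) (fun _ => (1 : ℝ)) ∂P N := by
      intro N
      rw [← integral_add (hEi ψ hψ N) (hEi ψ' hψ'c N), ← integral_const_mul]
      refine integral_congr_ae (Eventually.of_forall fun z => ?_)
      show empiricalEnergyField ((Φ N).flow t z) ψ + empiricalEnergyField ((Φ N).flow t z) ψ' =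
        W * empiricalEnergyField ((Φ N).flow t z) (fun _ => (1 : ℝ))
      rw [← empiricalEnergyField_add, ← empiricalEnergyField_const_mul]
      congr 1
      funext x
      rw [hψ'def]
      ring
    -- upper bound for `ψ`
    have hup : ∀ κ : ℝ, 0 < κ → ∀ᶠ N in atTop, ∫ z, empiricalEnergyField ((Φ N).flow t z) ψ ∂P N ≤ c + 2 * κ := by
      intro κ hκ
      have hWK : ∀ᶠ N in atTop, W * ∫ z, empiricalEnergyField ((Φ N).flow t z) (fun _ => (1 : ℝ)) ∂P N ≤ W * et + κ := by
        have h1 : Tendsto (fun N => W * ∫ z, empiricalEnergyField ((Φ N).flow t z) (fun _ => (1 : ℝ)) ∂P N) atTop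
            (𝓝 (W * et)) := hKT.const_mul W
        exact (h1.eventually (Iic_mem_nhds (by linarith : W * et < W * et + κ))).mono fun N h => h
      filter_upwards [hlow' κ hκ, hWK] with N h1 h2
      have h3 := hsum N
      linarith
    -- conclusion
    rw [tendsto_order]
    refine ⟨fun a ha => ?_, fun b hb => ?_⟩
    · have hκ : 0 < (c - a) / 2 := by linarith
      filter_upwards [hlow _ hκ] with N hN
      linarith
    · have hκ : 0 < (b - c) / 3 := by linarith
      filter_upwards [hup _ hκ] with N hN
      linarith
  have hET : Tendsto (fun N => ∫ z, empiricalEnergyField ((Φ N).flow t z) χ ∂P N) atTop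
      (𝓝 (∫ x, χ x * totalEnergyDensity (ρ t x) (u t x) (θ t x))) := by
    set χp : T3 → ℝ := fun x => max (χ x) 0 with hχp
    set χm : T3 → ℝ := fun x => max (-χ x) 0 with hχm
    have hχpc : Continuous χp := hχ.max continuous_const
    have hχmc : Continuous χm := hχ.neg.max continuous_const
    have hdec : ∀ x, χ x = χp x + (-1) * χm x := fun x => by
      rw [hχp, hχm]
      have := max_zero_sub_max_neg_zero_eq_self (χ x)
      linarith
    have hp := key χp hχpc fun x => le_max_right _ _
    have hm := key χm hχmc fun x => le_max_right _ _
    have hip : Integrable (fun x => χp x * totalEnergyDensity (ρ t x) (u t x) (θ t x)) (volume : Measure T3) :=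
      integrable_of_continuous_T3 (hχpc.mul hEtc)
    have him : Integrable (fun x => -1 * (χm x * totalEnergyDensity (ρ t x) (u t x) (θ t x))) (volume : Measure T3) :=
      (integrable_of_continuous_T3 (hχmc.mul hEtc)).const_mul _
    have hlim : (∫ x, χp x * totalEnergyDensity (ρ t x) (u t x) (θ t x)) + (-1) *
        ∫ x, χm x * totalEnergyDensity (ρ t x) (u t x) (θ t x) = ∫ x, χ x * totalEnergyDensity (ρ t x) (u t x) (θ t x) := by
      have e1 : (∫ x, χp x * totalEnergyDensity (ρ t x) (u t x) (θ t x)) +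
          ∫ x, -1 * (χm x * totalEnergyDensity (ρ t x) (u t x) (θ t x)) =
          ∫ x, (χp x * totalEnergyDensity (ρ t x) (u t x) (θ t x) + -1 * (χm x * totalEnergyDensity (ρ t x) (u t x) (θ t x))) :=
        (integral_add hip him).symm
      rw [← integral_const_mul, e1]
      refine integral_congr_ae (Eventually.of_forall fun x => ?_)
      show χp x * totalEnergyDensity (ρ t x) (u t x) (θ t x) + -1 * (χm x * totalEnergyDensity (ρ t x) (u t x) (θ t x)) =
        χ x * totalEnergyDensity (ρ t x) (u t x) (θ t x)
      rw [hdec x]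
      ring
    rw [← hlim]
    refine ((hp.add (hm.const_mul (-1))).congr fun N => ?_)
    rw [← integral_const_mul, ← integral_add (hEi χp hχpc N) ((hEi χm hχmc N).const_mul _)]
    refine integral_congr_ae (Eventually.of_forall fun z => ?_)
    show empiricalEnergyField ((Φ N).flow t z) χp + -1 * empiricalEnergyField ((Φ N).flow t z) χm =
      empiricalEnergyField ((Φ N).flow t z) χ
    rw [← empiricalEnergyField_const_mul, ← empiricalEnergyField_add]
    congr 1
    funext x
    exact (hdec x).symm
  /- ### Assembly -/
  exact ⟨Eventually.of_forall fun N => ⟨hDi N, hMi N, hEi χ hχ N⟩, hDT, hMT, hET⟩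

end Summit.AtomisticToContinuum.HydrodynamicLimit.Theorems.NearConstantShortTimeHL

end
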